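import Summits.QuantumFields.BalabanUV.T4Continuum.Support.RegionGramTwoLevel
import Summits.QuantumFields.BalabanUV.T4Continuum.Support.DirichletMonotoneExamples

/-!
# T⁴ programme, spine node NE2 (U1a), sub-row Δ1 «NE2⁰-Dirichlet» — THE TWO-LEVEL LAW OF THE REGION GRAM MATRIX
# `K_Ω = Q′_ΩG′_Ω²Q′_Ω*` ON EVERY LOCALLY MONOTONE UNION OF UNIT BLOCKS (boxes, L-shapes, complements of boxes, Fichera corners …)
# at the rate `(√L)⁻¹`: leaf (K) of the resolvent-split cut OFF BOXES

NE2 formalisation swarm `b2b-balaban-t4-ne2-formalise-*`, LEAF PROVER 09 (gen 10), supplier item «Δ1-VEC-K-MONOTONE» (journal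
`HOME/CLAIMS.log` 2026-08-21 l.23790).  The row-NE2 OWNER's first brick of the re-entrant (holed-region) front, O15-f
`RegionGaugeResolventTowerRegion.hinjK_of_local_of_slice` (p240623), reduces King's compressed injected law of the faithful region operator
`Δ_a(Ω₀)` on ANY union of unit blocks to four displayed leaves (L) (B) (Bᵗ) (K) given W1; its leaf (K) is
`hK : ∀ k, ‖(KcompR (lev L (k+1)) M a′ S)⁻¹ − (KcompR (lev L k) M a′ S)⁻¹‖ ≤ Ck·θ^k`.  On coordinate boxes leaf-01-g10's
`RegionGramTwoLevel.opNorm_KcompR_inv_sub_le_lev` (p238963) discharges it at the torus rate `θ = L⁻¹` from road P2's `injected_le_box`.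
THIS FILE discharges it on every LOCALLY MONOTONE union `S` (`DirichletMonotoneCutoff.LocallyMonotone`: every vertex patch of `S` is
downward- or upward-closed along every axis — boxes, slabs, L-shapes, complements of boxes, Fichera corners; NOT the checkerboard pair)
at the Besov rate `θ = (√L)⁻¹`, by bookkeeping over landed modules:

 * §1 (one step `n ↦ R·n`) **`opNorm_KcompR_sub_le_monotone`** `‖K_{Rn} − K_n‖ ≤ 2γ′⁻¹·(besovConst d a′ 6 48·√R/√n)` = leaf-01-g10's
   region-general `opNorm_KcompR_sub_le_of_injected` (‖K_{Rn} − K_n‖ ≤ 2γ′⁻¹·‖G′J_Ω − J_ΩG‖, ANY region) fed with leaf-08-g3's Besov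
   END `DirichletMonotoneTwoLevel.injected_le_of_locallyMonotone` (the scalar Dirichlet two-level injected law on locally monotone unions,
   rate `√R/√N`, no displayed binder); **`opNorm_KcompR_inv_sub_le_monotone`** for the inverses (`K′⁻¹ − K⁻¹ = K′⁻¹(K − K′)K⁻¹`,
   `‖K⁻¹‖ ≤ σ₀⁻²` twice);
 * §2 ALONG THE TOWER `n_k = lev L k` (`2 ≤ L`): **`opNorm_KcompR_inv_sub_le_lev_monotone`**
   `‖(KcompR (lev L (k+1)) M a′ S)⁻¹ − (KcompR (lev L k) M a′ S)⁻¹‖ ≤ CgramM·((√L)⁻¹)^k` with the level-free constant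
   `CgramM := (σ₀²)⁻¹(σ₀²)⁻¹·(2γ′⁻¹·(besovConst d a′ 6 48·√L))` (written inline, no new definition) — O15-f's `hK` VERBATIM with `Ck := CgramM`,
   `θ = (√L)⁻¹`;
   `opNorm_KcompR_sub_le_lev_monotone` for the Gram matrices themselves; **`hK_monotone`** = the same at any displayed rate
   `θ ∈ [(√L)⁻¹, ∞)` (the window of the compressed / renormalised star-tower ENDs);
 * §3 the COMPLEMENT OF A COORDINATE BOX (torus-minus-a-box, the one-hole geometry of the Δ1 census; W1 there is this lineage's
   `RegionGaugeBoxHole.sliceCoercive_boxHole` / `RegionGaugeHoled.sliceCoercive_holed`): **`opNorm_KcompR_inv_sub_le_lev_complBox`**,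
   **`hK_complBox`** via `DirichletMonotoneExamples.locallyMonotone_compl_of_isCoordBox`.

So on every locally monotone union the resolvent-split cut of `hinjK` displays (L), (B), (Bᵗ) only; (K) is a theorem at `(√L)⁻¹`.

HONEST FRAMING (T4-DAG p. 1).  Bookkeeping over landed modules ([folklore]); model level (`U = 1`, ONE region = a union of unit blocks,
ONE averaging scale, finite torus, operator norm); nothing printed is a hypothesis ([B9] Thm 3.2 (3.48) p.398 prints only η-UNIFORM
bounds for `(Q′G′²Q′*)⁻¹`; the two-spacing law is «not in print; our proof attempt»); ONE of four leaves — (L), (B), (Bᵗ) and the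
tower on re-entrant regions OPEN; `hinjK` ∕ W3 off boxes OPEN; Δ1 NOT closed; NE2 (U1a) NOT proved; spine PROVED 0/9 unchanged; NOT
[B9] (3.16)/(3.23)–(3.27)/(3.48) as printed; NOT infinite volume, NOT a mass gap, NOT the Clay problem, NOT summit progress.  HONEST
DEPENDENCY: continuum YM on T⁴ ⇐ BetaPertH ∧ nine spine estimates (0/9 proved); BetaPertH ⇐ (D1) ∧ (D4) ∧ CAP+tail; G-an2-4 gates
asym, D1 and NE2/3/4.  No `sorry`.
-/

noncomputable section

open scoped BigOperators ComplexConjugate Matrix Matrix.Norms.L2Operator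

namespace Summit.QuantumFields.BalabanUV.T4Continuum.RegionGramTwoLevelMonotone

open Literature.MathematicalPhysics.QuantumFieldTheory.Balaban1983to89.B5Prop11Plancherel (Tor fine)
open Literature.MathematicalPhysics.QuantumFieldTheory.Balaban1983to89.B5G183RateUnitTower (lev)
open Summit.QuantumFields.BalabanUV.T4Continuum
open Summit.QuantumFields.BalabanUV.T4Continuum.BalabanAveragedTowerUnit (one_le_lev' cast_lev')
open Summit.QuantumFields.BalabanUV.T4Continuum.ScalarAveragedPropagator (gammaPs gammaPs_pos)
open Summit.QuantumFields.BalabanUV.T4Continuum.ScalarAveragedCompression (sigma0 sigma0_pos)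
open Summit.QuantumFields.BalabanUV.T4Continuum.RegionScalarCompression (QOm GOm KcompR opNorm_KcompR_inv_le isUnit_det_KcompR)
open Summit.QuantumFields.BalabanUV.T4Continuum.RegionGramTwoLevel (opNorm_KcompR_sub_le_of_injected)
open Summit.QuantumFields.BalabanUV.T4Continuum.DirichletScalarTowerLevels (sqrt_lev)
open Summit.QuantumFields.BalabanUV.T4Continuum.DirichletScalarTowerMonotone (two_le_mul_lev)
open Summit.QuantumFields.BalabanUV.T4Continuum.DirichletBesovTwoLevel (besovConst besovConst_nonneg)
open Summit.QuantumFields.BalabanUV.T4Continuum.DirichletMonotoneCutoff (LocallyMonotone)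
open Summit.QuantumFields.BalabanUV.T4Continuum.DirichletMonotoneTwoLevel (injected_le_of_locallyMonotone)
open Summit.QuantumFields.BalabanUV.T4Continuum.DirichletMonotoneExamples (locallyMonotone_compl_of_isCoordBox)
open Summit.QuantumFields.BalabanUV.Beta.GAN24.DirichletBoxCompression (DOm JOm refineR)
open Summit.QuantumFields.BalabanUV.Beta.GAN24.DirichletBoxTrace (blockReg)
open Summit.QuantumFields.BalabanUV.Beta.GAN24.DirichletBoxTwoLevel (IsCoordBox)

variable {d : ℕ}

/-! ## §1 One step `n ↦ R·n` on a locally monotone union -/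

section OneStep

variable (n R : ℕ) [NeZero n] [NeZero R] (M : Fin d → ℕ) [hM : ∀ μ, NeZero (M μ)] (a' : ℝ) (S : Tor M → Prop) [DecidablePred S]

/-- **THE TWO-LEVEL LAW OF THE GRAM MATRIX ON A LOCALLY MONOTONE UNION** (`1 ≤ n`, `2 ≤ R·n`, `a′ > 0`):
`‖K_{Rn} − K_n‖ ≤ 2γ′⁻¹·(besovConst d a′ 6 48·√R/√n)` — leaf-01-g10's region-general `opNorm_KcompR_sub_le_of_injected` fed with the Besov
END `injected_le_of_locallyMonotone` BY NAME. [folklore] -/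
theorem opNorm_KcompR_sub_le_monotone (hS : LocallyMonotone M S) (hn : 1 ≤ n) (hRn : 2 ≤ R * n) (ha' : 0 < a') :
    ‖KcompR (R * n) M a' S - KcompR n M a' S‖
      ≤ 2 * (gammaPs d a')⁻¹ * (besovConst d a' 6 48 * Real.sqrt R / Real.sqrt n) := by
  have h := injected_le_of_locallyMonotone n R M S hS hn hRn ha'
  have e1 : (DOm (R * n) M a' (refineR n R M (blockReg n M S)))⁻¹ = (DOm (R * n) M a' (refineR n R M (blockReg n M S)))⁻¹ := rfl
  have e2 : (DOm n M a' (blockReg n M S))⁻¹ = GOm n M a' S := rfl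
  rw [e1, e2] at h
  exact opNorm_KcompR_sub_le_of_injected n R M a' S ha' h

/-- **THE TWO-LEVEL LAW OF THE INVERSE GRAM MATRIX ON A LOCALLY MONOTONE UNION**:
`‖K_{Rn}⁻¹ − K_n⁻¹‖ ≤ (σ₀²)⁻¹·(σ₀²)⁻¹·(2γ′⁻¹·(besovConst·√R/√n))` (`K′⁻¹ − K⁻¹ = K′⁻¹(K − K′)K⁻¹`, `‖K⁻¹‖ ≤ σ₀⁻²` twice). [folklore] -/
theorem opNorm_KcompR_inv_sub_le_monotone (hS : LocallyMonotone M S) (hn : 1 ≤ n) (hRn : 2 ≤ R * n) (ha' : 0 < a') :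
    ‖(KcompR (R * n) M a' S)⁻¹ - (KcompR n M a' S)⁻¹‖
      ≤ ((sigma0 d a') ^ 2)⁻¹ * ((sigma0 d a') ^ 2)⁻¹
          * (2 * (gammaPs d a')⁻¹ * (besovConst d a' 6 48 * Real.sqrt R / Real.sqrt n)) := by
  have hK' := isUnit_det_KcompR (R * n) M a' S ha'
  have hK := isUnit_det_KcompR n M a' S ha'
  have h1 : (KcompR (R * n) M a' S)⁻¹ * (KcompR n M a' S - KcompR (R * n) M a' S) * (KcompR n M a' S)⁻¹
      = (KcompR (R * n) M a' S)⁻¹ - (KcompR n M a' S)⁻¹ := by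
    rw [Matrix.mul_sub, Matrix.sub_mul, Matrix.mul_assoc, Matrix.mul_nonsing_inv _ hK, Matrix.mul_one, Matrix.nonsing_inv_mul _ hK',
      Matrix.one_mul]
  rw [← h1]
  have hσ : 0 ≤ ((sigma0 d a') ^ 2)⁻¹ := inv_nonneg.mpr (sq_nonneg _)
  have hdiff : ‖KcompR n M a' S - KcompR (R * n) M a' S‖
      ≤ 2 * (gammaPs d a')⁻¹ * (besovConst d a' 6 48 * Real.sqrt R / Real.sqrt n) := by
    rw [← norm_neg, neg_sub]; exact opNorm_KcompR_sub_le_monotone n R M a' S hS hn hRn ha'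
  have hA := opNorm_KcompR_inv_le (R * n) M a' S ha'
  have hC := opNorm_KcompR_inv_le n M a' S ha'
  have hb0 : 0 ≤ 2 * (gammaPs d a')⁻¹ * (besovConst d a' 6 48 * Real.sqrt R / Real.sqrt n) := le_trans (norm_nonneg _) hdiff
  calc ‖(KcompR (R * n) M a' S)⁻¹ * (KcompR n M a' S - KcompR (R * n) M a' S) * (KcompR n M a' S)⁻¹‖
      ≤ ‖(KcompR (R * n) M a' S)⁻¹ * (KcompR n M a' S - KcompR (R * n) M a' S)‖ * ‖(KcompR n M a' S)⁻¹‖ := Matrix.l2_opNorm_mul _ _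
    _ ≤ (‖(KcompR (R * n) M a' S)⁻¹‖ * ‖KcompR n M a' S - KcompR (R * n) M a' S‖) * ‖(KcompR n M a' S)⁻¹‖ :=
        mul_le_mul_of_nonneg_right (Matrix.l2_opNorm_mul _ _) (norm_nonneg _)
    _ ≤ (((sigma0 d a') ^ 2)⁻¹ * (2 * (gammaPs d a')⁻¹ * (besovConst d a' 6 48 * Real.sqrt R / Real.sqrt n))) * ((sigma0 d a') ^ 2)⁻¹ :=
        mul_le_mul (mul_le_mul hA hdiff (norm_nonneg _) hσ) hC (norm_nonneg _) (mul_nonneg hσ hb0)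
    _ = _ := by ring

end OneStep

/-! ## §2 Along the tower `n_k = lev L k` -/

section Tower

variable (L : ℕ) [NeZero L] (M : Fin d → ℕ) [hM : ∀ μ, NeZero (M μ)] (a' : ℝ) (S : Tor M → Prop) [DecidablePred S]

/-- the constant of the law along the tower on locally monotone unions (written INLINE in every statement; no new definition),
`CgramM := (σ₀²)⁻¹·(σ₀²)⁻¹·(2γ′⁻¹·(besovConst d a′ 6 48·√L))` (level-free; the `√L` is the Besov END's `√R`), is nonnegative. [folklore] -/
theorem CgramM_nonneg (d L : ℕ) (a' : ℝ) :
    0 ≤ ((sigma0 d a') ^ 2)⁻¹ * ((sigma0 d a') ^ 2)⁻¹ * (2 * (gammaPs d a')⁻¹ * (besovConst d a' 6 48 * Real.sqrt (L : ℝ))) := by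
  have hγ : 0 ≤ (gammaPs d a')⁻¹ := inv_nonneg.mpr (gammaPs_pos (d := d) (a' := a')).1.le
  have hb := besovConst_nonneg d a' 6 48
  positivity

omit [NeZero L] in
/-- the Besov shape along the tower: `√L/√(n_k) = √L·((√L)⁻¹)^k`. [folklore] -/
theorem sqrt_div_sqrt_lev (k : ℕ) :
    Real.sqrt (L : ℝ) / Real.sqrt ((lev L k : ℕ) : ℝ) = Real.sqrt (L : ℝ) * ((Real.sqrt (L : ℝ))⁻¹) ^ k := by
  rw [sqrt_lev, div_eq_mul_inv, ← inv_pow]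

/-- **(K) ALONG THE TOWER ON A LOCALLY MONOTONE UNION** (`2 ≤ L`, `a′ > 0`): for every `k`,
`‖(KcompR (lev L (k+1)) M a′ S)⁻¹ − (KcompR (lev L k) M a′ S)⁻¹‖ ≤ CgramM·((√L)⁻¹)^k` — the owner's leaf (K) of
`RegionGaugeResolventTowerRegion.hinjK_of_local_of_slice` VERBATIM with `Ck := CgramM`, `θ = (√L)⁻¹`. [folklore] -/
theorem opNorm_KcompR_inv_sub_le_lev_monotone (hS : LocallyMonotone M S) (hL : 2 ≤ L) (ha' : 0 < a') (k : ℕ) :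
    ‖(KcompR (lev L (k + 1)) M a' S)⁻¹ - (KcompR (lev L k) M a' S)⁻¹‖ ≤ ((sigma0 d a') ^ 2)⁻¹ * ((sigma0 d a') ^ 2)⁻¹ * (2 * (gammaPs d a')⁻¹ * (besovConst d a' 6 48 * Real.sqrt (L : ℝ)))
        * ((Real.sqrt (L : ℝ))⁻¹) ^ k := by
  have h := opNorm_KcompR_inv_sub_le_monotone (lev L k) L M a' S hS (one_le_lev' L k) (two_le_mul_lev L hL k) ha'
  rw [mul_div_assoc, sqrt_div_sqrt_lev L k] at h
  refine h.trans (le_of_eq ?_)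
  ring

/-- the same for the Gram matrices themselves:
`‖KcompR (lev L (k+1)) − KcompR (lev L k)‖ ≤ 2γ′⁻¹·(besovConst d a′ 6 48·√L)·((√L)⁻¹)^k`. [folklore] -/
theorem opNorm_KcompR_sub_le_lev_monotone (hS : LocallyMonotone M S) (hL : 2 ≤ L) (ha' : 0 < a') (k : ℕ) :
    ‖KcompR (lev L (k + 1)) M a' S - KcompR (lev L k) M a' S‖
      ≤ 2 * (gammaPs d a')⁻¹ * (besovConst d a' 6 48 * Real.sqrt (L : ℝ)) * ((Real.sqrt (L : ℝ))⁻¹) ^ k := by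
  have h := opNorm_KcompR_sub_le_monotone (lev L k) L M a' S hS (one_le_lev' L k) (two_le_mul_lev L hL k) ha'
  rw [mul_div_assoc, sqrt_div_sqrt_lev L k] at h
  refine h.trans (le_of_eq ?_)
  ring

/-- **`hK` AT ANY DISPLAYED RATE `θ ≥ (√L)⁻¹`** (the window `[(√L)⁻¹, 1)` of the star-tower ENDs): on a locally monotone union,
`∀ k, ‖(KcompR (lev L (k+1)) M a′ S)⁻¹ − (KcompR (lev L k) M a′ S)⁻¹‖ ≤ CgramM·θ^k`. [folklore] -/
theorem hK_monotone (hS : LocallyMonotone M S) (hL : 2 ≤ L) (ha' : 0 < a') {θ : ℝ} (hθ : (Real.sqrt (L : ℝ))⁻¹ ≤ θ) (k : ℕ) :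
    ‖(KcompR (lev L (k + 1)) M a' S)⁻¹ - (KcompR (lev L k) M a' S)⁻¹‖
      ≤ ((sigma0 d a') ^ 2)⁻¹ * ((sigma0 d a') ^ 2)⁻¹ * (2 * (gammaPs d a')⁻¹ * (besovConst d a' 6 48 * Real.sqrt (L : ℝ))) * θ ^ k := by
  refine (opNorm_KcompR_inv_sub_le_lev_monotone L M a' S hS hL ha' k).trans ?_
  exact mul_le_mul_of_nonneg_left (pow_le_pow_left₀ (inv_nonneg.mpr (Real.sqrt_nonneg _)) hθ k) (CgramM_nonneg d L a')

/-! ## §3 The complement of a coordinate box -/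

/-- **(K) ON THE COMPLEMENT OF A COORDINATE BOX** (torus-minus-a-box; `2 ≤ L`, `a′ > 0`): for every `k`,
`‖(KcompR (lev L (k+1)) M a′ Sᶜ)⁻¹ − (KcompR (lev L k) M a′ Sᶜ)⁻¹‖ ≤ CgramM·((√L)⁻¹)^k`. [folklore] -/
theorem opNorm_KcompR_inv_sub_le_lev_complBox (hS : IsCoordBox M S) (hL : 2 ≤ L) (ha' : 0 < a') (k : ℕ) :
    ‖(KcompR (lev L (k + 1)) M a' (fun b => ¬ S b))⁻¹ - (KcompR (lev L k) M a' (fun b => ¬ S b))⁻¹‖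
      ≤ ((sigma0 d a') ^ 2)⁻¹ * ((sigma0 d a') ^ 2)⁻¹ * (2 * (gammaPs d a')⁻¹ * (besovConst d a' 6 48 * Real.sqrt (L : ℝ)))
        * ((Real.sqrt (L : ℝ))⁻¹) ^ k :=
  opNorm_KcompR_inv_sub_le_lev_monotone L M a' (fun b => ¬ S b) (locallyMonotone_compl_of_isCoordBox M hS) hL ha' k

/-- `hK` on the complement of a coordinate box at any displayed rate `θ ≥ (√L)⁻¹`. [folklore] -/
theorem hK_complBox (hS : IsCoordBox M S) (hL : 2 ≤ L) (ha' : 0 < a') {θ : ℝ} (hθ : (Real.sqrt (L : ℝ))⁻¹ ≤ θ) (k : ℕ) :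
    ‖(KcompR (lev L (k + 1)) M a' (fun b => ¬ S b))⁻¹ - (KcompR (lev L k) M a' (fun b => ¬ S b))⁻¹‖
      ≤ ((sigma0 d a') ^ 2)⁻¹ * ((sigma0 d a') ^ 2)⁻¹ * (2 * (gammaPs d a')⁻¹ * (besovConst d a' 6 48 * Real.sqrt (L : ℝ))) * θ ^ k :=
  hK_monotone L M a' (fun b => ¬ S b) (locallyMonotone_compl_of_isCoordBox M hS) hL ha' hθ k

end Tower

end Summit.QuantumFields.BalabanUV.T4Continuum.RegionGramTwoLevelMonotone

end
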